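import Literature.Analysis.FunctionSpaces.SobolevBallScaling
import Literature.Analysis.FunctionSpaces.ConvexLipschitzDomain
import HarnessLib

/-!
# LINE 25 «compactness_transfer» (stmt-QuantumFields-23533), S2♭″ brick (Γ5a) «SOBOLEV CELL-AVERAGE ROWS», FILE A —
# SCALED POINCARÉ–WIRTINGER FOR SOBOLEV MAPS ON HOMOTHETIC COPIES OF A CONVEX BODY: `‖f − ⨍_Ω f‖_{L^p(Ω)} ≤ C(Ω₁,p)·γ·‖Df‖_{L^p(Ω)}` for `Ω = x₀ + γ·Ω₁`

Cell `ym3-torus` (YM ladder rung R3 — a RUNG, NOT the Clay problem: not d = 4, not infinite volume, not a mass gap); WIDTH COPY «width 15» of ym3-torus-p1,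
gen 6; helper `--supports stmt-QuantumFields-23533`.  THEOREMS ONLY (0 `def`, default heartbeats); SUMMIT-INDEPENDENT, over the tree's Sobolev library
(lit ✓`SobolevBallScaling`: `affinePreimage`, `MemSobolevDomain.comp_affine_one`, `HasWeakFDerivOn.comp_affine`, `eLpNorm_comp_affine`,
`setAverage_preimage_comp_affine`; ✓`poincare_wirtinger_holds` (Poincaré–Wirtinger on bounded connected Lipschitz domains); ✓`isLipschitzDomain_of_convex`).

WHY (LEAD w1 g10 12:29:32Z S2♭″ ARCHITECTURE v0, brick (Γ5a) → px15; row (a-iii) «`R³∫_{cell}‖V − a_R y‖² ≤ C_P·R·∫_{cell} dens`»).  The recovery sequence for a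
GENERAL `W^{1,2}(Q; S³)` competitor samples cell AVERAGES `a_R y = R³∫_{cell_y} V`; its oscillation row is Poincaré–Wirtinger on the cell with the constant
scaling like the cell's side `R⁻¹`.  The tree has Poincaré–Wirtinger with an existential constant PER DOMAIN; THIS FILE supplies the scaling law once and for
all: ★★`exists_eLpNorm_sub_average_le_affine` — for a bounded convex nonempty open `Ω₁` and `1 ≤ p` there is `C` with
`eLpNorm (f − ⨍_Ω f) p (volume.restrict Ω) ≤ C · ofReal γ · eLpNorm g p (volume.restrict Ω)` for EVERY `Ω` with `affinePreimage γ x₀ Ω = Ω₁` (`γ > 0`), every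
`f ∈ W^{1,p}(Ω)` (`MemSobolevDomain 1 p Ω volume f`) and weak derivative `g` (`HasWeakFDerivOn Ω volume f g`) — the pattern of lit ✓`exists_eLpNorm_sub_average_le_ball`
(balls, with the Sobolev exponent) specialised to `p′ = p` and generalised to convex bodies; ★`exists_eLpNorm_sq_sub_average_le_affine` the squared `L²` form.  FILE B
(`…SobolevCellAverages`) instantiates `Ω₁ :=` the open unit cube, `Ω :=` a grid cell `y∕R + R⁻¹·Π(0,1)`.  HONEST SCOPE: scaling bookkeeping over landed Literature;
NOTHING here proves Γ5, S2♭″, the organ, `BlockLipschitzL`, `HistoryTailL`, or any summit statement; YM₃ on T³ is rung R3, not Clay. [cite: Evans2010, §5.8.1 Thm. 1]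
(Gilbarg–Trudinger (7.45)).
-/

noncomputable section

open MeasureTheory Set Function Filter TopologicalSpace Metric Module
open scoped NNReal ENNReal Topology

namespace Summit.QuantumFields.YangMills.Theorems.PoincareLipschitzSobolevScaledPoincareWirtinger

open Literature.Analysis.FunctionSpaces

variable {E : Type*} [NormedAddCommGroup E] [InnerProductSpace ℝ E] [FiniteDimensional ℝ E]
  [MeasurableSpace E] [BorelSpace E]
variable {F : Type*} [NormedAddCommGroup F] [NormedSpace ℝ F] [CompleteSpace F]

omit [FiniteDimensional ℝ E] [MeasurableSpace E] [BorelSpace E] in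
/-- The underlying set of an affine preimage, as a preimage. [folklore] -/
theorem preimage_eq_of_affinePreimage_eq {γ : ℝ} {x₀ : E} {Ω Ω₁ : Opens E}
    (hpre : affinePreimage γ x₀ Ω = Ω₁) :
    (fun y : E => x₀ + γ • y) ⁻¹' (Ω : Set E) = (Ω₁ : Set E) := by
  rw [← coe_affinePreimage, hpre]

/-- The scaling factor `(γ⁻ⁿ)^{1/p}` of `eLpNorm_comp_affine` is neither `0` nor `∞`. [folklore] -/
theorem affine_factor_ne_zero_ne_top {γ : ℝ} (hγ : 0 < γ) (n : ℕ) (p : ℝ≥0∞) :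
    (ENNReal.ofReal (γ ^ n)⁻¹) ^ (1 / p).toReal ≠ 0 ∧
      (ENNReal.ofReal (γ ^ n)⁻¹) ^ (1 / p).toReal ≠ ∞ := by
  have h0 : ENNReal.ofReal (γ ^ n)⁻¹ ≠ 0 := (ENNReal.ofReal_pos.2 (by positivity)).ne'
  exact ⟨(ENNReal.rpow_pos (pos_iff_ne_zero.2 h0) ENNReal.ofReal_ne_top).ne',
    ENNReal.rpow_ne_top_of_nonneg ENNReal.toReal_nonneg ENNReal.ofReal_ne_top⟩

/-- ★★ **SCALED POINCARÉ–WIRTINGER ON HOMOTHETIC COPIES OF A CONVEX BODY** (Sobolev version,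
`1 ≤ p`). Let `Ω₁ ⊆ E` be a bounded convex nonempty open set. There is `C = C(Ω₁, p)` such that
for EVERY homothetic copy `Ω = x₀ + γ·Ω₁` (`γ > 0`, recorded as `affinePreimage γ x₀ Ω = Ω₁`),
every `f ∈ W^{1,p}(Ω; F)` and every weak derivative `g` of `f` on `Ω`,
`‖f − ⨍_Ω f‖_{L^p(Ω)} ≤ C · γ · ‖g‖_{L^p(Ω)}` — the constant scales like the DIAMETER. From the
tree's Poincaré–Wirtinger on Lipschitz domains (`poincare_wirtinger_holds`, convex ⇒ Lipschitz by
`isLipschitzDomain_of_convex`) on `Ω₁` and the affine change of variables `x = x₀ + γ y` of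
`SobolevBallScaling` (`MemSobolevDomain.comp_affine_one`, `HasWeakFDerivOn.comp_affine`,
`eLpNorm_comp_affine`, `setAverage_preimage_comp_affine`): both sides pick up `(γ⁻ⁿ)^{1/p}`, the
derivative an extra `γ`. [cite: Evans2010, §5.8.1 Thm. 1] -/
theorem exists_eLpNorm_sub_average_le_affine (Ω₁ : Opens E) (hconv : Convex ℝ (Ω₁ : Set E))
    (hbdd : Bornology.IsBounded (Ω₁ : Set E)) (hne : (Ω₁ : Set E).Nonempty)
    {p : ℝ≥0∞} (hp : 1 ≤ p) :
    ∃ C : ℝ≥0, ∀ (x₀ : E) (γ : ℝ), 0 < γ → ∀ (Ω : Opens E), affinePreimage γ x₀ Ω = Ω₁ →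
      ∀ (f : E → F) (g : E → E →L[ℝ] F), MemSobolevDomain 1 p Ω volume f →
      HasWeakFDerivOn Ω volume f g →
      eLpNorm (fun x => f x - ⨍ y in (Ω : Set E), f y) p (volume.restrict (Ω : Set E)) ≤
        C * ENNReal.ofReal γ * eLpNorm g p (volume.restrict (Ω : Set E)) := by
  have hconn : IsConnected (Ω₁ : Set E) := ⟨hne, hconv.isPreconnected⟩
  obtain ⟨CP, hCP⟩ := poincare_wirtinger_holds (E' := E) (F := F)
    (isLipschitzDomain_of_convex hconv hbdd) hbdd hconn p hp volume
  refine ⟨CP, fun x₀ γ hγ Ω hpre f g hf hg => ?_⟩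
  have hpreS : (fun y : E => x₀ + γ • y) ⁻¹' (Ω : Set E) = (Ω₁ : Set E) :=
    preimage_eq_of_affinePreimage_eq hpre
  -- transport to `Ω₁`
  set f₁ : E → F := fun y => f (x₀ + γ • y) with hf₁def
  set g₁ : E → E →L[ℝ] F := fun y => γ • g (x₀ + γ • y) with hg₁def
  have hf₁ : MemSobolevDomain 1 p Ω₁ volume f₁ := hpre ▸ hf.comp_affine_one hγ x₀
  have hg₁ : HasWeakFDerivOn Ω₁ volume f₁ g₁ := hpre ▸ hg.comp_affine hγ x₀
  set m : F := ⨍ y in (Ω : Set E), f y with hm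
  have hmean : ⨍ y in (Ω₁ : Set E), f₁ y = m := by
    rw [← hpreS]; exact setAverage_preimage_comp_affine hγ x₀ f (Ω : Set E)
  -- Poincaré–Wirtinger on `Ω₁`
  have hP : eLpNorm (fun y => f₁ y - m) p (volume.restrict (Ω₁ : Set E)) ≤
      CP * eLpNorm g₁ p (volume.restrict (Ω₁ : Set E)) := by
    have := hCP f₁ g₁ hf₁ hg₁
    rwa [hmean] at this
  -- the two norms under the change of variables
  set c : ℝ≥0∞ := (ENNReal.ofReal (γ ^ finrank ℝ E)⁻¹) ^ (1 / p).toReal with hc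
  obtain ⟨hc0, hct⟩ := affine_factor_ne_zero_ne_top hγ (finrank ℝ E) p
  have e1 : eLpNorm (fun y => f₁ y - m) p (volume.restrict (Ω₁ : Set E)) =
      c * eLpNorm (fun x => f x - m) p (volume.restrict (Ω : Set E)) := by
    rw [← hpreS]
    exact eLpNorm_comp_affine hγ x₀ (fun x => f x - m) p (Ω : Set E)
  have e2 : eLpNorm g₁ p (volume.restrict (Ω₁ : Set E)) =
      ENNReal.ofReal γ * (c * eLpNorm g p (volume.restrict (Ω : Set E))) := by
    have h3 : eLpNorm g₁ p (volume.restrict ((fun y : E => x₀ + γ • y) ⁻¹' (Ω : Set E))) =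
        ‖γ‖ₑ * eLpNorm (fun y : E => g (x₀ + γ • y)) p
          (volume.restrict ((fun y : E => x₀ + γ • y) ⁻¹' (Ω : Set E))) :=
      eLpNorm_const_smul γ (fun y : E => g (x₀ + γ • y)) p _
    rw [← hpreS, h3, Real.enorm_eq_ofReal hγ.le, eLpNorm_comp_affine hγ x₀ g p (Ω : Set E)]
  rw [e1, e2] at hP
  -- cancel the common factor `c`
  have hP' : c * eLpNorm (fun x => f x - m) p (volume.restrict (Ω : Set E)) ≤
      c * (CP * ENNReal.ofReal γ * eLpNorm g p (volume.restrict (Ω : Set E))) := by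
    calc c * eLpNorm (fun x => f x - m) p (volume.restrict (Ω : Set E))
        ≤ CP * (ENNReal.ofReal γ * (c * eLpNorm g p (volume.restrict (Ω : Set E)))) := hP
      _ = c * (CP * ENNReal.ofReal γ * eLpNorm g p (volume.restrict (Ω : Set E))) := by ring
  exact (ENNReal.mul_le_mul_iff_right hc0 hct).1 hP'

/-- ★ **Squared `L²` form**: under the same hypotheses with `p = 2`,
`∫⁻_Ω ‖f − ⨍_Ω f‖ₑ² ≤ C² γ² ∫⁻_Ω ‖g‖ₑ²` (squares of the previous inequality,
`eLpNorm_two_eq`-style bookkeeping kept in `eLpNorm` currency: `(eLpNorm · 2)^2`). [folklore] -/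
theorem exists_eLpNorm_sq_sub_average_le_affine (Ω₁ : Opens E) (hconv : Convex ℝ (Ω₁ : Set E))
    (hbdd : Bornology.IsBounded (Ω₁ : Set E)) (hne : (Ω₁ : Set E).Nonempty) :
    ∃ C : ℝ≥0, ∀ (x₀ : E) (γ : ℝ), 0 < γ → ∀ (Ω : Opens E), affinePreimage γ x₀ Ω = Ω₁ →
      ∀ (f : E → F) (g : E → E →L[ℝ] F), MemSobolevDomain 1 2 Ω volume f →
      HasWeakFDerivOn Ω volume f g →
      eLpNorm (fun x => f x - ⨍ y in (Ω : Set E), f y) 2 (volume.restrict (Ω : Set E)) ^ 2 ≤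
        (C : ℝ≥0∞) ^ 2 * ENNReal.ofReal γ ^ 2 * eLpNorm g 2 (volume.restrict (Ω : Set E)) ^ 2 := by
  obtain ⟨C, hC⟩ := exists_eLpNorm_sub_average_le_affine (F := F) Ω₁ hconv hbdd hne
    (p := 2) (by norm_num)
  refine ⟨C, fun x₀ γ hγ Ω hpre f g hf hg => ?_⟩
  have h := hC x₀ γ hγ Ω hpre f g hf hg
  calc eLpNorm (fun x => f x - ⨍ y in (Ω : Set E), f y) 2 (volume.restrict (Ω : Set E)) ^ 2
      ≤ (C * ENNReal.ofReal γ * eLpNorm g 2 (volume.restrict (Ω : Set E))) ^ 2 := by gcongr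
    _ = (C : ℝ≥0∞) ^ 2 * ENNReal.ofReal γ ^ 2 * eLpNorm g 2 (volume.restrict (Ω : Set E)) ^ 2 := by
        ring

end Summit.QuantumFields.YangMills.Theorems.PoincareLipschitzSobolevScaledPoincareWirtinger

end
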